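import Mathlib
import HarnessLib
import Summits.Langlands.Langlands.Theses.ParityBlindBianchi
import Summits.Langlands.Langlands.Theses.RuelleTorsionArtinWeight
import Summits.Langlands.Langlands.Theorems.ParityBlindBianchiArtinWeightRealisationLevelCuspFormsDischarged
import Literature.NumberTheory.Automorphic.CaraianiNewtonModularity
import Literature.NumberTheory.Automorphic.PiOfArtinRepAtSigmaUnramifiedPlaces
import Literature.NumberTheory.Automorphic.StrongArtinGL2

/-!
# SKELETON — crux stmt-Langlands-15111 `ParityBlindBianchi.ArtinWeightRealisationLevel` (R′),
# line `SketchIdeator4` = idea `cap-wall-patching-e5-door` (round 2, ideator 4)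

Lead prover-line-stmt-Langlands-15111-a1-0, 2026-08-17.  Built from the ideator's
`Cruxes/ArtinWeightRealisationLevel/SketchIdeator4.lean` (rc 0, 0 sorries, hypotheses as `def … : Prop`)
by turning its four propositions and the two classical named facts it consumes into six registered
`stub_*` theorems; `ArtinWeightRealisationLevel_of` proves the crux BY NAME from them through the
landed `artinWeightRealisationLevel_of_artinWeightRealisation_insoluble_of_gelbart` (p115022).
Sorries: exactly the six stubs.  The two parametrised predicates `DoorOutput`, `GL4HostPattern`
are the card's (verbatim); they are not tree declarations (card item D1 asks crux-plan for them).
-/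

noncomputable section

open scoped BigOperators Topology Classical Matrix Polynomial NumberField
open Filter Set Function
open Literature.NumberTheory.Automorphic Literature.NumberTheory.GaloisRepresentations
  IsDedekindDomain

set_option linter.dupNamespace false

namespace Summit.Langlands.Langlands.Theorems.ArtinWeightRealisationLevel

/-- `5` is prime (instance needed to speak of `ℚ̄₅ = PadicAlgCl 5`). [folklore] -/
instance fact_prime_five : Fact (Nat.Prime 5) := ⟨by norm_num⟩

/-- **Door output over `L`** (card `cap-wall-patching-e5-door`, verbatim): a modular `E/L`, a
finite-order `χ : Γ_L → ℚ̄_pˣ` and `ι₅ : ℚ̄₅ ≃ ℂ` with `tr σ|_L(Frob_w) ≡ χ(Frob_w)·a_w(E)` modulo the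
maximal ideal of `ℤ̄₅` at a.e. `w` (the cofinite trace shadow of `r̄_{E,5} ≅ σ̄|_L ⊗ χ̄`). [folklore] -/
def DoorOutput (K : Type) [Field K] [NumberField K] (p : ℕ) [Fact p.Prime]
    (ι : PadicAlgCl p ≃+* ℂ) (σ : FramedGaloisRep K (PadicAlgCl p) 2)
    (L : Type) [Field L] [NumberField L] [Algebra K L] : Prop :=
  ∃ (E : WeierstrassCurve (𝓞 L)) (χ : FramedGaloisRep L (PadicAlgCl p) 1)
    (ι₅ : PadicAlgCl 5 ≃+* ℂ),
    E.Δ ≠ 0 ∧ IsModularEllipticCurve L E ∧ Finite χ.toMonoidHom.range ∧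
      ∀ᶠ w : HeightOneSpectrum (𝓞 L) in cofinite,
        ∃ (P Q : Polynomial (PadicAlgCl p)),
          (σ.restrictField L).IsUnramifiedAt w ∧ (σ.restrictField L).HasFrobCharpolyAt w P ∧
            χ.IsUnramifiedAt w ∧ χ.HasFrobCharpolyAt w Q ∧
              ‖ι₅.symm (ι (P.coeff 1) - ι (Q.coeff 0) * (frobTraceAt E w : ℂ))‖ < 1

/-- **Host pattern** over a number field `L` (card, verbatim the sibling's `GL4HostPattern`): an
automorphic representation `Θ` of `GL₄(𝔸_L)` whose Satake multiset at a.e. `v` is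
`A·q_v^{-1/2} ⊎ B·q_v^{1/2}` with `B` unitary and `A` carrying the arithmetic-Frobenius polynomial
of `σ`. [folklore] -/
def GL4HostPattern (L : Type) [Field L] [NumberField L] (p : ℕ) [Fact p.Prime]
    (ι : PadicAlgCl p ≃+* ℂ) (σ : FramedGaloisRep L (PadicAlgCl p) 2) : Prop :=
  ∃ (hcpt4 : isCompact_glFiniteIntegralLevel 4 L)
    (Θ : AutomorphicRepData (AutomorphyDatum.gl 4 L hcpt4)),
    ∀ᶠ v : HeightOneSpectrum (𝓞 L) in cofinite, ∃ A B : Multiset ℂ,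
      Θ.HasSatakeParamAt v
          (A.map (fun a ↦ a * (((Real.sqrt (v.residueCard : ℝ) : ℝ) : ℂ))⁻¹) +
            B.map (fun b ↦ b * ((Real.sqrt (v.residueCard : ℝ) : ℝ) : ℂ))) ∧
        (∀ b ∈ B, ‖b‖ = 1) ∧
        σ.IsUnramifiedAt v ∧ σ.HasFrobCharpolyAt v (arithFrobPolyOfSatake ι v.residueCard 1 A)

/-! ## The six registered stubs -/

/-- **stub_e5Door** (card K2, `E5Door`): the E[5]-door — for `K` totally complex and `σ` finite-image
irreducible with insoluble projective image there is a solvable Galois, totally complex `L/K` over which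
`σ` stays irreducible insoluble and a door output (modular `E/L` with `r̄_{E,5} ≅ σ̄|_L ⊗ χ̄`).
Claimed in print up to assembly: Shepherd-Barron–Taylor 1997; AKT23 Prop. 9.13; Caraiani–Newton
Prop. 6.1.5 / Lemma 6.1.4 / Thm. 6.1. [cite: CaraianiNewton2023, Prop. 6.1.5] -/
theorem stub_e5Door :
    ∀ (K : Type) [Field K] [NumberField K], NumberField.IsTotallyComplex K →
    ∀ (p : ℕ) [Fact p.Prime] (ι : PadicAlgCl p ≃+* ℂ) (σ : FramedGaloisRep K (PadicAlgCl p) 2),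
      Finite σ.toMonoidHom.range → σ.toGaloisRep.IsIrreducible →
        ¬ IsSolvable (projectiveImage σ.toMonoidHom) →
          ∃ (L : Type) (_ : Field L) (_ : NumberField L) (_ : Algebra K L) (_ : IsGalois K L),
            IsSolvable (L ≃ₐ[K] L) ∧ NumberField.IsTotallyComplex L ∧
              Finite (σ.restrictField L).toMonoidHom.range ∧
              (σ.restrictField L).toGaloisRep.IsIrreducible ∧
              ¬ IsSolvable (projectiveImage (σ.restrictField L).toMonoidHom) ∧
                DoorOutput K p ι σ L := by
  sorry

/-- **stub_capWallHost** (card K1, `CAPWallHost`, THE NEW CRUX — not in print): residually-CAP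
Calegari–Geraghty patching of the ordinary higher Hida complex of `U(2,2)/L⁺` at the scalar-weight-2
wall ⇒ the Artin–CAP pseudocharacter is carried by a classical coherent class ⇒ (Harris–Zucker + Mok)
the GL₄/L host pattern for `σ|_L`. [folklore] -/
theorem stub_capWallHost :
    ∀ (K : Type) [Field K] [NumberField K], NumberField.IsTotallyComplex K →
    ∀ (p : ℕ) [Fact p.Prime] (ι : PadicAlgCl p ≃+* ℂ) (σ : FramedGaloisRep K (PadicAlgCl p) 2)
      (L : Type) [Field L] [NumberField L] [Algebra K L] [IsGalois K L],
      IsSolvable (L ≃ₐ[K] L) → NumberField.IsTotallyComplex L →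
        Finite (σ.restrictField L).toMonoidHom.range →
          (σ.restrictField L).toGaloisRep.IsIrreducible →
            ¬ IsSolvable (projectiveImage (σ.restrictField L).toMonoidHom) →
              DoorOutput K p ι σ L → GL4HostPattern L p ι (σ.restrictField L) := by
  sorry

/-- **stub_gl4HostExit** (card P1, `GL4HostExit`, verbatim the sibling's): exit by cuspidal support
(Langlands 1979 Prop. 2 + Jacquet–Shalika bounds + Chebotarev/Brauer–Nesbitt). [cite: Langlands1979Notion, Prop. 2] -/
theorem stub_gl4HostExit :
    ∀ (L : Type) [Field L] [NumberField L] (p : ℕ) [Fact p.Prime] (ι : PadicAlgCl p ≃+* ℂ)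
    (σ : FramedGaloisRep L (PadicAlgCl p) 2), Finite σ.toMonoidHom.range →
      σ.toGaloisRep.IsIrreducible → GL4HostPattern L p ι σ →
        ∃ (hcpt : isCompact_glFiniteIntegralLevel 2 L) (π : CuspidalAutomorphicRepData 2 L hcpt),
          ∀ᶠ w : HeightOneSpectrum (𝓞 L) in cofinite,
            Summit.Langlands.SatakeFrobCompatibleAt ι π.1 σ w := by
  sorry

/-- **stub_solvableArtinDescentAE** (card K3, `SolvableArtinDescentAE`): a.e. automorphy of `σ|_L` for
`L/K` solvable Galois and `σ` insoluble-projective ⇒ a.e. automorphy of `σ` over `K` (claimed: Langlands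
1980 / Arthur–Clozel III.4.2 bootstrapped along a cyclic tower). [cite: ArthurClozelAMS120, Ch. 3 Thm. 4.2] -/
theorem stub_solvableArtinDescentAE :
    ∀ (K : Type) [Field K] [NumberField K] (p : ℕ) [Fact p.Prime] (ι : PadicAlgCl p ≃+* ℂ)
    (σ : FramedGaloisRep K (PadicAlgCl p) 2) (L : Type) [Field L] [NumberField L] [Algebra K L]
    [IsGalois K L], IsSolvable (L ≃ₐ[K] L) → Finite σ.toMonoidHom.range →
      σ.toGaloisRep.IsIrreducible → ¬ IsSolvable (projectiveImage σ.toMonoidHom) →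
        (∃ (hcptL : isCompact_glFiniteIntegralLevel 2 L) (πL : CuspidalAutomorphicRepData 2 L hcptL),
          ∀ᶠ w : HeightOneSpectrum (𝓞 L) in cofinite,
            Summit.Langlands.SatakeFrobCompatibleAt ι πL.1 (σ.restrictField L) w) →
        ∃ (hcpt : isCompact_glFiniteIntegralLevel 2 K) (π : CuspidalAutomorphicRepData 2 K hcpt),
          ∀ᶠ v : HeightOneSpectrum (𝓞 K) in cofinite,
            Summit.Langlands.SatakeFrobCompatibleAt ι π.1 σ v := by
  sorry

/-- **stub_strongArtinOfIsSolvable** = the NAMED FACT `strongArtin_of_isSolvable` (Langlands–Tunnell in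
automorphic form, Gelbart 1997 Thm. 2.1), consumed by the closing kit for the solvable sector.
[cite: Gelbart1997, Thm. 2.1] -/
theorem stub_strongArtinOfIsSolvable : strongArtin_of_isSolvable := by
  sorry

/-- **stub_gelbartShadow** = the NAMED FACT `frobSatakeCompatibleAt_of_isPiOfArtinRep_of_isUnramifiedAt`
(Gelbart 1997 Prop. 4.1, σ-unramified shadow ⇐ JL 1970 twisted Hecke theory), consumed by the closing
kit for "a.e. ⇒ every good place". [cite: Gelbart1997, Prop. 4.1] -/
theorem stub_gelbartShadow : frobSatakeCompatibleAt_of_isPiOfArtinRep_of_isUnramifiedAt := by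
  sorry

/-! ## Composition -/

/-- **Insoluble Artin over totally complex fields, a.e., with NO occurrence hypothesis** — the line's
Transfer C⁺, from stubs 1–4 (door → wall → exit → descent). [folklore] -/
theorem insolubleArtinAE_of_stubs :
    ∀ (K : Type) [Field K] [NumberField K], NumberField.IsTotallyComplex K →
    ∀ (p : ℕ) [Fact p.Prime] (ι : PadicAlgCl p ≃+* ℂ) (σ : FramedGaloisRep K (PadicAlgCl p) 2),
      Finite σ.toMonoidHom.range → σ.toGaloisRep.IsIrreducible →
        ¬ IsSolvable (projectiveImage σ.toMonoidHom) →
          ∃ (hcpt : isCompact_glFiniteIntegralLevel 2 K) (π : CuspidalAutomorphicRepData 2 K hcpt),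
            ∀ᶠ v : HeightOneSpectrum (𝓞 K) in cofinite,
              Summit.Langlands.SatakeFrobCompatibleAt ι π.1 σ v := by
  intro K _ _ hK p _ ι σ hfin hirr hins
  obtain ⟨L, _, _, _, _, hsolv, hL, hfinL, hirrL, hinsL, hOut⟩ := stub_e5Door K hK p ι σ hfin hirr hins
  have hHost : GL4HostPattern L p ι (σ.restrictField L) :=
    stub_capWallHost K hK p ι σ L hsolv hL hfinL hirrL hinsL hOut
  obtain ⟨hcptL, πL, hπL⟩ := stub_gl4HostExit L p ι (σ.restrictField L) hfinL hirrL hHost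
  exact stub_solvableArtinDescentAE K p ι σ L hsolv hfin hirr hins ⟨hcptL, πL, hπL⟩

/-- **The crux BY NAME** from the six stubs, through the accepted
`artinWeightRealisationLevel_of_artinWeightRealisation_insoluble_of_gelbart` (p115022). The occurrence
hypothesis of R′ is discarded at the insoluble core (the card's design). [folklore] -/
theorem ArtinWeightRealisationLevel_of :
    Summit.Langlands.Langlands.Theses.ParityBlindBianchi.ArtinWeightRealisationLevel := by
  refine artinWeightRealisationLevel_of_artinWeightRealisation_insoluble_of_gelbart
    stub_strongArtinOfIsSolvable stub_gelbartShadow ?_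
  intro K _ _ hK _h2 p _ ι σ hfin hirr hins _hocc
  exact insolubleArtinAE_of_stubs K hK p ι σ hfin hirr hins

end Summit.Langlands.Langlands.Theorems.ArtinWeightRealisationLevel

end
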